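import Literature.NumberTheory.EllipticCurves.Sprung2012.HondaLevelTwoDualCoordinatesProofs
import Literature.Algebra.Module.PadicDualLatticeRank
import HarnessLib

/-!
# Sprung 2012 Thm. 2.2 / Lemma 2.3 / Cor. 2.10 at level `2`, PRIMAL form modulo Silverman AEC VII.6.3: the free-coordinate
# map `Hom(E(K_2·K_v), ℤ_p) → ℤ_p^{p²}` is ONTO — every coordinate vector is a functional (proofs only; part 1 of the
# (IND) discharge, part 2 = `ColemanMapJointCokernelIndependenceProofs.lean`)

Topic `Literature/NumberTheory/EllipticCurves`, cluster `Sprung2012` (namespace = path). A THEOREMS file (no definition, no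
named fact; net Literature debt `0`). Cell `bsd-ssimc`, width seat `cruxlead-stmt-BirchSwinnertonDyer-19875-w3` (gen 7), in
support of the x8 cruxes stmt-BirchSwinnertonDyer-22569 `KatoFineLowerSporadicX8` / 22901 `CyclotomicLowerPosLevelX8` through
the cokernel bound F-α (`Summits/…/SignedLowerHalvesSprungLowerDivisibilityAtThreeCokerBoundSkeleton.lean`, hypothesis `hcoker`).
F. E. I. Sprung, *Iwasawa theory for elliptic curves at supersingular primes: A pair of main conjectures*, J. Number Theory
**132** (2012) [Sprung2012]; M. Kurihara, R. Pollack (2007) Prop. 1.2 and A. Lei, R. Sujatha (2021) §3 for the exact sequence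
(SES-KP) `0 → H¹_Iw(T) → Λ² → ℤ_p → 0`. The cokernel half «`T·Λ² ⊆ Col(H¹_Iw)`» was proved in
`Sprung2012/ColemanMapJointCokernelProofs.lean` (w2 g8) MODULO the clause (IND) «`c₋₁` and
`q = ∑_{j<p²} C(j,p)·gʲc_2 − 2·∑_{j<p} j·gʲc_1` are `𝔽_p`-independent in `E(K_∞·K_v)/p`», a RANK statement the tree's
`IsHondaSystem` (generation in dual form) cannot supply. This pair of files proves (IND) from the lattice clause of
Silverman AEC VII Prop. 6.3 with IV Thm. 6.4 (b) («`E(K_2·K_v) ⊇` a finite-index subgroup `≅ ℤ_p^{[K_2·K_v : ℚ_p]}`»; over `ℚ`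
the named fact `silvermanVII63_localLayerPoints_finiteIndex_zpLattice`, INPUTS desk, `LocalPointsFiniteIndexLattice.lean`); THIS
file (part 1) is the rank step: the free-coordinate map on functionals is onto.

## The proof (this part)

(`exists_functional_of_coordinates`) The free-coordinate map `Φ : Hom(E(K_2·K_v), ℤ_p) → ℤ_p^{p²}`,
`z ↦ ((z(gʳc_1))_{r<p}, (z(g^{r+pi}c_2))_{r<p, i<p−1})`, is `ℤ_p`-linear, INJECTIVE and has `p`-SATURATED image (the
level-`2` generation clauses of `IsHondaSystem` in coordinates, `Sprung2012/HondaLevelTwoDualCoordinatesProofs.lean`);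
`E(K_2·K_v)` contains `ℤ_p^{p²}` with finite index (Silverman VII.6.3 as a HYPOTHESIS `hL` here + `[K_2·K_v : K_v] = p²`,
`index_localLayerSubgroupOfEmb_eq_pow_of_isTopGenerator`); hence `Φ` is ONTO
(`Literature.Algebra.Module.surjective_of_injective_of_saturated`, rank count over the PID `ℤ_p`): EVERY coordinate vector is
the coordinate vector of a functional — the primal content of Thm. 2.2 / Lemma 2.3 («`Ê(𝔪_2)` is `ℤ_p`-free of rank `p²`»,
the `Γ_2`-orbits of `c_2, c_1` modulo the trace relations a basis). Also the value of a functional at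
`q = ∑_{j<p²} C(j,p)·gʲc_2 − 2·∑_{j<p} j·gʲc_1` (`evalOn_honda_q_of_le`). Part 2 builds from this two functionals separating
`c₋₁` and `q` modulo `p` and concludes (IND).

HONEST FRAMING: the lattice hypothesis `hL` is Silverman AEC VII.6.3 at the layer `n = 2` (over `ℚ` it is the cite-only
named fact `silvermanVII63_localLayerPoints_finiteIndex_zpLattice`, a textbook theorem typed but not proved in the tree);
nothing here needs `K = ℚ` or `p` odd; nothing about any Selmer group, the ♯/♭ main conjectures or BSD is asserted or proved;
the Birch–Swinnerton-Dyer conjecture is NOT proved by any of this.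

## References
* [Sprung2012] F. E. I. Sprung, J. Number Theory 132 (2012) 1483–1506: Thm. 2.2, Lemma 2.3, Cor. 2.10 (pp. 1487–1489);
  Def. 3.1 (p. 1489); Def. 5.9 (p. 1495); Def. 7.1–7.2, Props. 7.3/7.6, Lemmas 7.4–7.5 (pp. 1500–1501); Lemma 7.10 (p. 1503).
* [SilvermanAEC2009] J. H. Silverman, *The Arithmetic of Elliptic Curves*, 2nd ed., VII Prop. 6.3, IV Thm. 6.4 (b).
* [KuriharaPollack2007] M. Kurihara, R. Pollack, Prop. 1.2. [LeiSujatha2021] A. Lei, R. Sujatha, §3 (SES-KP).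
* Tree: `Sprung2012/{ColemanMaps, HondaLevelTwoRelationsProofs, HondaLevelTwoDualCoordinatesProofs}.lean`,
  `LocalPointsFiniteIndexLattice.lean`, `Algebra/Module/PadicDualLatticeRank.lean`.
-/

noncomputable section

open scoped Classical NumberField

open Polynomial Finset

universe u

namespace Literature.NumberTheory.EllipticCurves.Sprung2012

open Literature.NumberTheory.EllipticCurves Literature.NumberTheory.GaloisRepresentations ZpExtension
  Literature.NumberTheory.EllipticCurves.Kobayashi2003 Literature.NumberTheory.EllipticCurves.Sprung2017

/-! ## §0 Unfolding API: functionals extended by zero (`evalOn`) -/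

section Plumbing

variable {K : Type u} [Field K] {p : ℕ} [Fact p.Prime]
variable {E : Type u} [Field E] [Algebra K E] {W : WeierstrassCurve K}

/-- A functional extended by zero is additive on its subgroup (unfolding API of the
transcription of Def. 3.1). [cite: Sprung2012, Def. 3.1 (p. 1489) (unfolding)] -/
theorem evalOn_map_add_of_mem (A : AddSubgroup (localPoints W E)) (z : A →+ ℤ_[p])
    {P Q : localPoints W E} (hP : P ∈ A) (hQ : Q ∈ A) :
    evalOn W A z (P + Q) = evalOn W A z P + evalOn W A z Q := by
  rw [evalOn_of_mem W A z (add_mem hP hQ), evalOn_of_mem W A z hP, evalOn_of_mem W A z hQ, ← map_add]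
  rfl

/-- A functional extended by zero is subtractive on its subgroup (unfolding API of the
transcription of Def. 3.1). [cite: Sprung2012, Def. 3.1 (p. 1489) (unfolding)] -/
theorem evalOn_map_sub_of_mem (A : AddSubgroup (localPoints W E)) (z : A →+ ℤ_[p])
    {P Q : localPoints W E} (hP : P ∈ A) (hQ : Q ∈ A) :
    evalOn W A z (P - Q) = evalOn W A z P - evalOn W A z Q := by
  rw [evalOn_of_mem W A z (sub_mem hP hQ), evalOn_of_mem W A z hP, evalOn_of_mem W A z hQ, ← map_sub]
  rfl

/-- A functional extended by zero commutes with `ℤ`-multiples on its subgroup (unfolding API of the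
transcription of Def. 3.1). [cite: Sprung2012, Def. 3.1 (p. 1489) (unfolding)] -/
theorem evalOn_map_zsmul_of_mem (A : AddSubgroup (localPoints W E)) (z : A →+ ℤ_[p])
    {P : localPoints W E} (hP : P ∈ A) (k : ℤ) :
    evalOn W A z (k • P) = (k : ℤ_[p]) * evalOn W A z P := by
  rw [evalOn_of_mem W A z (zsmul_mem hP k), evalOn_of_mem W A z hP, ← zsmul_eq_mul, ← map_zsmul]
  rfl

/-- A functional extended by zero commutes with `ℕ`-multiples on its subgroup (unfolding API of the
transcription of Def. 3.1). [cite: Sprung2012, Def. 3.1 (p. 1489) (unfolding)] -/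
theorem evalOn_map_nsmul_of_mem (A : AddSubgroup (localPoints W E)) (z : A →+ ℤ_[p])
    {P : localPoints W E} (hP : P ∈ A) (k : ℕ) :
    evalOn W A z (k • P) = (k : ℤ_[p]) * evalOn W A z P := by
  rw [evalOn_of_mem W A z (nsmul_mem hP k), evalOn_of_mem W A z hP, ← nsmul_eq_mul, ← map_nsmul]
  rfl

/-- A functional extended by zero is additive over finite sums inside its subgroup (unfolding API of the
transcription of Def. 3.1). [cite: Sprung2012, Def. 3.1 (p. 1489) (unfolding)] -/
theorem evalOn_map_sum_of_mem (A : AddSubgroup (localPoints W E)) (z : A →+ ℤ_[p])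
    {α : Type*} (s : Finset α) (P : α → localPoints W E) (hP : ∀ a ∈ s, P a ∈ A) :
    evalOn W A z (∑ a ∈ s, P a) = ∑ a ∈ s, evalOn W A z (P a) := by
  classical
  induction s using Finset.induction_on with
  | empty =>
    rw [sum_empty, sum_empty, evalOn_of_mem W A z A.zero_mem]
    exact map_zero z
  | insert a s ha ih =>
    rw [sum_insert ha, sum_insert ha,
      evalOn_map_add_of_mem A z (hP a (mem_insert_self a s)) (A.sum_mem fun b hb => hP b (mem_insert_of_mem hb)),
      ih fun b hb => hP b (mem_insert_of_mem hb)]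

/-- Extension by zero is additive in the functional (unfolding API of the
transcription of Def. 3.1). [cite: Sprung2012, Def. 3.1 (p. 1489) (unfolding)] -/
theorem evalOn_add_apply_of_mem (A : AddSubgroup (localPoints W E)) (z z' : A →+ ℤ_[p]) {P : localPoints W E}
    (hP : P ∈ A) : evalOn W A (z + z') P = evalOn W A z P + evalOn W A z' P := by
  rw [evalOn_of_mem W A _ hP, evalOn_of_mem W A _ hP, evalOn_of_mem W A _ hP, AddMonoidHom.add_apply]

/-- Extension by zero is `ℤ_p`-homogeneous in the functional (unfolding API of the
transcription of Def. 3.1). [cite: Sprung2012, Def. 3.1 (p. 1489) (unfolding)] -/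
theorem evalOn_smul_apply_of_mem (A : AddSubgroup (localPoints W E)) (a : ℤ_[p]) (z : A →+ ℤ_[p])
    {P : localPoints W E} (hP : P ∈ A) : evalOn W A (a • z) P = a * evalOn W A z P := by
  rw [evalOn_of_mem W A _ hP, evalOn_of_mem W A _ hP, AddMonoidHom.smul_apply, smul_eq_mul]

end Plumbing

/-! ## §1 The free-coordinate map on `Hom(E(K_2·K_v), ℤ_p)` is ONTO `ℤ_p^{p²}` -/

section Local

variable {K : Type u} [Field K] {p : ℕ} [Fact p.Prime] {κ : ZpExtension K p}
variable {E : Type u} [Field E] [Algebra K E] {ι : AlgebraicClosure K →ₐ[K] AlgebraicClosure E}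
variable {W : WeierstrassCurve K}

/-- **Every coordinate vector is the free-coordinate vector of a functional on `E(K_2·K_v)`** (Thm. 2.2 / Lemma 2.3 /
Cor. 2.10 at level `2`, primal content: the `Γ_2`-orbits of `c_2`, `c_1` modulo the trace relations are a `ℤ_p`-BASIS of the
`p`-adic completion of `E(K_2·K_v)`). Hypotheses: `p ∣ a_p`, `g` a lift of the topological generator, `(c₋₁, c)` a Honda
system, and (Silverman AEC VII.6.3 at the layer `n = 2`) a finite-index subgroup `H ≅ ℤ_p^{[Γ_{K_v} : Gal(K̄_v/K_2·K_v)]}` of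
`E(K_2·K_v)`. Then for all `(y_r)_{r<p}`, `(x_{r,i})_{r<p, i<p−1}` there is `z : E(K_2·K_v) →+ ℤ_p` with `z(gʳc_1) = y_r`,
`z(g^{r+pi}c_2) = x_{r,i}` — the free-coordinate map is injective (`eq_zero_of_coordinates_eq_zero`) with `p`-saturated image
(`exists_of_coordinates_eq_prime_mul`), into `ℤ_p^{p²}` with `p² = [Γ_{K_v} : Gal(K̄_v/K_2·K_v)]`
(`index_localLayerSubgroupOfEmb_eq_pow_of_isTopGenerator`), hence onto (`Literature.Algebra.Module.surjective_of_injective_of_saturated`).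
[cite: Sprung2012, Thm. 2.2, Lemma 2.3 (pp. 1487–1488), Cor. 2.10 (p. 1489)] [cite: SilvermanAEC2009, VII Prop. 6.3] -/
theorem exists_functional_of_coordinates {ap : ℤ} (hap : (p : ℤ) ∣ ap) {g : Field.absoluteGaloisGroup E}
    (hg : κ.IsTopGenerator (resGalOfEmb ι g)) {cneg : localPoints W E} {c : ℕ → localPoints W E}
    (hH : IsHondaSystem κ ι W ap g cneg c)
    (hL : ∃ H : AddSubgroup (localPoints W E), H ≤ localLayerPointsOfEmb κ ι W 2 ∧
      (H.addSubgroupOf (localLayerPointsOfEmb κ ι W 2)).FiniteIndex ∧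
      Nonempty (H ≃+ (Fin (localLayerSubgroupOfEmb κ ι 2).index → ℤ_[p])))
    (y : ℕ → ℤ_[p]) (x : ℕ → ℕ → ℤ_[p]) :
    ∃ z : localLayerPointsOfEmb κ ι W 2 →+ ℤ_[p],
      (∀ r < p, evalOn W (localLayerPointsOfEmb κ ι W 2) z (g ^ r • c 1) = y r) ∧
      (∀ r < p, ∀ i < p - 1, evalOn W (localLayerPointsOfEmb κ ι W 2) z (g ^ (r + p * i) • c 2) = x r i) := by
  have hp : p.Prime := Fact.out
  obtain ⟨H, hHle, hHfi, ⟨e⟩⟩ := hL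
  haveI := hHfi
  obtain ⟨hc2A, hc1A, -⟩ := honda_orbit_mem (le_refl (localLayerPointsOfEmb κ ι W 2)) hH
  -- the free-coordinate map
  let Φ : (localLayerPointsOfEmb κ ι W 2 →+ ℤ_[p]) →ₗ[ℤ_[p]] (Fin p ⊕ (Fin p × Fin (p - 1)) → ℤ_[p]) :=
    { toFun := fun z => Sum.elim (fun r : Fin p => evalOn W (localLayerPointsOfEmb κ ι W 2) z (g ^ (r : ℕ) • c 1))
        (fun ri : Fin p × Fin (p - 1) =>
          evalOn W (localLayerPointsOfEmb κ ι W 2) z (g ^ ((ri.1 : ℕ) + p * (ri.2 : ℕ)) • c 2))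
      map_add' := fun z z' => funext fun s => by
        rcases s with r | ri
        · simp only [Sum.elim_inl, Pi.add_apply]
          exact evalOn_add_apply_of_mem _ z z' (hc1A _)
        · simp only [Sum.elim_inr, Pi.add_apply]
          exact evalOn_add_apply_of_mem _ z z' (hc2A _)
      map_smul' := fun a z => funext fun s => by
        rcases s with r | ri
        · simp only [Sum.elim_inl, Pi.smul_apply, RingHom.id_apply, smul_eq_mul]
          exact evalOn_smul_apply_of_mem _ a z (hc1A _)
        · simp only [Sum.elim_inr, Pi.smul_apply, RingHom.id_apply, smul_eq_mul]
          exact evalOn_smul_apply_of_mem _ a z (hc2A _) }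
  have hΦl : ∀ z (r : Fin p), Φ z (Sum.inl r) = evalOn W (localLayerPointsOfEmb κ ι W 2) z (g ^ (r : ℕ) • c 1) :=
    fun _ _ => rfl
  have hΦr : ∀ z (ri : Fin p × Fin (p - 1)), Φ z (Sum.inr ri) =
      evalOn W (localLayerPointsOfEmb κ ι W 2) z (g ^ ((ri.1 : ℕ) + p * (ri.2 : ℕ)) • c 2) := fun _ _ => rfl
  -- injective
  have hinj : Function.Injective Φ := by
    rw [← LinearMap.ker_eq_bot, LinearMap.ker_eq_bot']
    intro z hz
    refine eq_zero_of_coordinates_eq_zero hap hg hH z (fun r hr => ?_) (fun r hr i hi => ?_)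
    · rw [← hΦl z ⟨r, hr⟩, hz, Pi.zero_apply]
    · rw [← hΦr z (⟨r, hr⟩, ⟨i, hi⟩), hz, Pi.zero_apply]
  -- `p`-saturated
  have hsat : ∀ w, (p : ℤ_[p]) • w ∈ LinearMap.range Φ → w ∈ LinearMap.range Φ := by
    rintro w ⟨z, hz⟩
    obtain ⟨z', hy', hx'⟩ := exists_of_coordinates_eq_prime_mul hap hg hH
      (fun r => if hr : r < p then w (Sum.inl ⟨r, hr⟩) else 0)
      (fun r i => if h : r < p ∧ i < p - 1 then w (Sum.inr (⟨r, h.1⟩, ⟨i, h.2⟩)) else 0) z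
      (fun r hr => by rw [dif_pos hr, ← hΦl z ⟨r, hr⟩, hz, Pi.smul_apply, smul_eq_mul])
      (fun r hr i hi => by rw [dif_pos ⟨hr, hi⟩, ← hΦr z (⟨r, hr⟩, ⟨i, hi⟩), hz, Pi.smul_apply, smul_eq_mul])
    refine ⟨z', funext fun s => ?_⟩
    rcases s with ⟨r, hr⟩ | ⟨⟨r, hr⟩, ⟨i, hi⟩⟩
    · rw [hΦl, hy' r hr, dif_pos hr]
    · rw [hΦr, hx' r hr i hi, dif_pos ⟨hr, hi⟩]
  -- ranks: `#σ = p + p(p−1) = p² = [Γ_{K_v} : Gal(K̄_v/K_2·K_v)]`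
  have hcard : Fintype.card (Fin p ⊕ (Fin p × Fin (p - 1))) ≤
      Fintype.card (Fin (localLayerSubgroupOfEmb κ ι 2).index) := by
    rw [Fintype.card_sum, Fintype.card_prod, Fintype.card_fin, Fintype.card_fin, Fintype.card_fin,
      index_localLayerSubgroupOfEmb_eq_pow_of_isTopGenerator κ ι hg 2]
    have h1 : p * (p - 1) + p = p * p := by
      rw [← Nat.mul_succ, Nat.succ_eq_add_one, Nat.sub_add_cancel hp.one_le]
    rw [pow_two]
    omega
  have hsurj := Literature.Algebra.Module.surjective_of_injective_of_saturated
    (H.addSubgroupOf (localLayerPointsOfEmb κ ι W 2)) ((AddSubgroup.addSubgroupOfEquivOfLe hHle).trans e)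
    hcard Φ hinj hsat
  obtain ⟨z, hz⟩ := hsurj (Sum.elim (fun r : Fin p => y r) (fun ri : Fin p × Fin (p - 1) => x ri.1 ri.2))
  refine ⟨z, fun r hr => ?_, fun r hr i hi => ?_⟩
  · rw [← hΦl z ⟨r, hr⟩, hz, Sum.elim_inl]
  · rw [← hΦr z (⟨r, hr⟩, ⟨i, hi⟩), hz, Sum.elim_inr]

/-! ## §2 The value of a functional at `q` -/

variable {A : AddSubgroup (localPoints W E)}

/-- The value of an additive `z` on `A ⊇ E(K_2·K_v)` at `q = ∑_{j<p²} C(j,p)·gʲc_2 − 2·∑_{j<p} j·gʲc_1` is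
`∑_{j<p²} C(j,p)·z(gʲc_2) − 2·∑_{j<p} j·z(gʲc_1)` (as `evalOn_honda_q`, for any such `A`). [cite: Sprung2012, Def. 3.1 (p. 1489)] -/
theorem evalOn_honda_q_of_le (hA : localLayerPointsOfEmb κ ι W 2 ≤ A) {ap : ℤ} {g : Field.absoluteGaloisGroup E}
    {cneg : localPoints W E} {c : ℕ → localPoints W E} (hH : IsHondaSystem κ ι W ap g cneg c) (z : A →+ ℤ_[p]) :
    evalOn W A z (∑ j ∈ range (p ^ 2), (j.choose p) • (g ^ j • c 2) - 2 • ∑ j ∈ range p, j • (g ^ j • c 1)) =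
      ∑ j ∈ range (p ^ 2), (j.choose p : ℤ_[p]) * evalOn W A z (g ^ j • c 2) -
        2 * ∑ j ∈ range p, (j : ℤ_[p]) * evalOn W A z (g ^ j • c 1) := by
  obtain ⟨hc2A, hc1A, -⟩ := honda_orbit_mem hA hH
  have h2 : ∑ j ∈ range (p ^ 2), (j.choose p) • (g ^ j • c 2) ∈ A :=
    A.sum_mem fun j _ => A.nsmul_mem (hc2A j) _
  have h1 : ∑ j ∈ range p, j • (g ^ j • c 1) ∈ A := A.sum_mem fun j _ => A.nsmul_mem (hc1A j) _
  rw [evalOn_map_sub_of_mem A z h2 (A.nsmul_mem h1 _), evalOn_map_nsmul_of_mem A z h1,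
    evalOn_map_sum_of_mem A z _ _ fun j _ => A.nsmul_mem (hc2A j) _,
    evalOn_map_sum_of_mem A z _ _ fun j _ => A.nsmul_mem (hc1A j) _, Nat.cast_ofNat]
  congr 1
  · exact sum_congr rfl fun j _ => evalOn_map_nsmul_of_mem A z (hc2A j) _
  · congr 1
    exact sum_congr rfl fun j _ => evalOn_map_nsmul_of_mem A z (hc1A j) _

end Local

end Literature.NumberTheory.EllipticCurves.Sprung2012

end
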